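/-
Copyright: cell `pub-ymgap` (HUMAN RULING D-0062), Track A of `YM-PLAN.md`, DAG node N20 (= NE7b); R134 acceleration seat
`pub-ymgap-dag-n20-c` (strategy s1, generation 3), module 13.  Released under the licence of the surrounding project.
-/
import Summits.QuantumFields.YangMills.Theorems.BalabanUVNodesN20LCSConditional
import HarnessLib

/-!
# YM-DAG node N20 (= NE7b), strategy s1, module 13: CONDITIONAL «LCS-0» FOR PLAQUETTE SETS and in the HISTORY-TERM CURRENCY — the
# small-field-restricted state is non-null (module 10b), local exponential moments of plaquette energies conditioned on the global small-field
# event are `≤ e^{C·(t∕β)·#Q}`, and the same as the two conjuncts of `LocCondStability`'s shape for the density `∏_p 𝟙[small]·e^{−βA}`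

Track A of `YM-PLAN.md` (cell `pub-ymgap`, HUMAN RULING D-0062), node **N20** = spine estimate NE7b (`T4WeightBudget.RelWeightBound` — the
cell `pub-balaban`'s OWN estimate, NOT PRINTED in [Bałaban 1983–89], NOT PROVED).  Seat `pub-ymgap-dag-n20-c` (R134, s1), module 13 (module 12:
`…Theorems.BalabanUVNodesN20LCSConditional` — conditional «LCS-0» for cube energies, restricted state assumed non-null).  Kernel theorems only:
0 `def`, 0 `sorry`, standard axioms; COUNT-NEUTRAL; `--supports` the K3′ item `SpineGivenEndpointR12` (stmt-QuantumFields-19908) as a helper.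
Nothing of Bałaban's is asserted: the objects are the cell's `Missing.expect ∕ Missing.boltzmann ∕ fieldMeasure ∕ GaugeField.plaqHol ∕ reTr` on
`T^{(0)}` of a `d = 4` parameter set, `SU(N)`, and the host's `wilsonAction ∕ WilsonRP.plaqRe ∕ partitionFunction`, read BY NAME.

WHAT IS PROVED ([folklore]; dictionary + counting on top of modules 10b, 12):
* §4 `expect_eq_host_ratio` (`⟨F⟩_{P,β} = ∫F(ofConfig V)e^{−(β∕N)S}dHaar ∕ ∫e^{−(β∕N)S}dHaar`), ★ **`expect_smallField_pos`** — `∃ c > 0, ∀ P (d = 4),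
  β ≥ 4N, βε ≥ c: 0 < ⟨∏_p 𝟙[1 − Re tr U(∂p) ≤ ε]⟩_{P,β}`: the small-field-RESTRICTED level-0 state of record is NON-NULL (module 10b's restricted
  Gaussian lower bound `restricted_torus_lower_axisHolonomy`), discharging module 12's hypothesis.
* §5 `plaqSum_le_cubeSum` (`Σ_{p∈Q} A_p ≤ Σ_{c ∈ x(Q)} E_c`: every plaquette lies in the closed unit cube of its base point),
  ★★ **`condLCS_exp_plaqSum`** — `∃ C ≥ 0, c > 0, ∀ P (d = 4), β ≥ 4N, βε ≥ c, 0 ≤ t ≤ β∕32, ∀ Q ⊆ plaquettes: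
  ⟨e^{tΣ_{p∈Q}(1 − Re tr U(∂p))}·∏_p 𝟙[1 − Re tr U(∂p) ≤ ε]⟩_{P,β} ∕ ⟨∏_p 𝟙[…]⟩_{P,β} ≤ exp(C·(t∕β)·#Q)` — the CONDITIONAL twin of module 7's
  `expect_exp_plaqSum_le` (`t = aβ`): local exponential moments of plaquette energies at the natural scale, conditioned on the global small-field
  event, uniformly in `β` and the volume.
* §6 ★ **`condLCS_boltzmann`** — the same un-normalised, as the two conjuncts of `Spine/NE7b/LocalConditionalStability.LocCondStability`'s shape
  for the restricted level-0 density `χ_ε·e^{−βA}` (`χ_ε = ∏_p 𝟙[small]`): `Integrable (M·χ_ε·e^{−βA}) ∏dU` and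
  `∫ M·χ_ε·e^{−βA} ∏dU ≤ e^{C(t∕β)#Q}·∫ χ_ε·e^{−βA} ∏dU`, `M = e^{tΣ_{p∈Q}(1 − Re tr U(∂p))}` (module 7's `lcs_boltzmann` is the unrestricted case).

HONEST FRAMING.  This closes, in kernel, the seat lineage's located residual (ii) of `N20-S1-TRIAGE.md` §1 AT LEVEL 0 for the ALL-PLAQUETTE
small-field restriction (the leading history): «LCS in the history term's own state» for the density `χ_ε·ρ₀`.  NOT here: the push-forward
to level 1 along Bałaban's averaging (module 1's `lcs_coarse_iff_fine` + residual (i), the domination letter for `avOfRecord`, seat n20-d),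
histories with large-field regions (their densities break the reflection symmetry the chessboard uses), levels `≥ 2` ((A1c)), the (α)-instance
itself (NC-NE7b-α UNRULED).  NE7b NOT PRINTED ∕ NOT PROVED; (α)-instance 0∕1; N20 NOT discharged; typed 28∕28, discharged count untouched;
NOT ℝ⁴, NOT infinite volume, NOT OS axioms, NOT a mass gap, NOT Clay.
-/

set_option autoImplicit false

noncomputable section

namespace Summit.QuantumFields.YangMills.BalabanUVNodes.N20LCSConditional

open MeasureTheory Finset
open Literature.MathematicalPhysics.QuantumFieldTheory
open Literature.MathematicalPhysics.QuantumFieldTheory.Balaban1983to89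
open Literature.MathematicalPhysics.QuantumLattice (fundamentalRep continuous_fundamentalRep fundamentalRep_injective
  fundamentalRep_mem_unitaryGroup)
open Literature.Barriers.CriticalPhenomena.NonGibbs (BlockIdx)
open Summit.QuantumFields.YangMills.BalabanUVNodes.N20LCSRestrictedDoubling (restricted_torus_lower_axisHolonomy restrictedPF_ne_top
  smallField_nonneg_le_one)
open Summit.QuantumFields.YangMills.BalabanUVNodes.N20LCSRestrictedChessboard (expect_mul_prod_mono expect_mul_prod_nonneg cubeEnergy_mem
  measurable_cubeEnergy plaqTerm_mem)

variable {N : ℕ} [NeZero N]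

/-! ## §4 The restricted state of record is NON-NULL: `⟨∏_p 𝟙[1 − Re tr U(∂p) ≤ ε]⟩_{P,β} > 0` for `βε ≥ c` (module 10b's lower bound) -/

section NonNull

/-- **THE CELL's EXPECTATION AS A HOST RATIO**: for a `d`-dimensional parameter set, every real observable `F` of the level-0 field has
`⟨F⟩_{P,β} = (∫ F(ofConfig V)·e^{−(β∕N)S(V)} dHaar(V)) ∕ ∫ e^{−(β∕N)S(V)} dHaar(V)`, `S` the host's Wilson action of the fundamental representation
(`integral_gibbsMeasure_eq_expect` + `integral_gibbsMeasure_eq_integral_wilsonMeasure` + `wilsonExpectation_eq_integral_div`). [folklore] -/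
theorem expect_eq_host_ratio (P : Params) {β : ℝ} (hβ : 0 ≤ β) (F : GaugeField P 0 (Matrix.specialUnitaryGroup (Fin N) ℂ) → ℝ) :
    Missing.expect (G := Matrix.specialUnitaryGroup (Fin N) ℂ) P β F =
      (∫ V, F (ofConfig V) * Real.exp (-(β / N) * wilsonAction (fundamentalRep (Fin N)) V)
          ∂(Measure.pi fun _ : Edge P.d (P.sitesPerDir 0) => haarProbability (Matrix.specialUnitaryGroup (Fin N) ℂ))) /
        ∫ V, Real.exp (-(β / N) * wilsonAction (fundamentalRep (Fin N)) V)
          ∂(Measure.pi fun _ : Edge P.d (P.sitesPerDir 0) => haarProbability (Matrix.specialUnitaryGroup (Fin N) ℂ)) := by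
  rw [← T4GenFunBounds.integral_gibbsMeasure_eq_expect P hβ,
    GibbsMeasureWilsonDictionary.integral_gibbsMeasure_eq_integral_wilsonMeasure P hβ]
  exact wilsonExpectation_eq_integral_div (fundamentalRep (Fin N)) (continuous_fundamentalRep (Fin N)) (β / N) _

/-- **THE SMALL-FIELD-RESTRICTED LEVEL-0 STATE OF RECORD IS NON-NULL.**  There is `c = c(N) > 0` such that for every `d = 4` parameter set
`P`, every `β ≥ 4N` and every threshold with `βε ≥ c`: `0 < ⟨∏_p 𝟙[1 − Re tr U(∂p) ≤ ε]⟩_{P,β}` (module 10b's restricted Gaussian lower bound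
`restricted_torus_lower_axisHolonomy` through the dictionary). [folklore] -/
theorem expect_smallField_pos (N : ℕ) [NeZero N] :
    ∃ c : ℝ, 0 < c ∧ ∀ (P : Params), P.d = 4 → ∀ (β ε : ℝ), 4 * N ≤ β → c ≤ β * ε →
      0 < Missing.expect (G := Matrix.specialUnitaryGroup (Fin N) ℂ) P β (fun U => ∏ p : Plaq P 0, (if 1 - reTr (GaugeField.plaqHol U p) ≤ ε then (1 : ℝ) else 0)) := by
  let r : LatticeRep (Matrix.specialUnitaryGroup (Fin N) ℂ) :=
    ⟨N, fundamentalRep (Fin N), continuous_fundamentalRep (Fin N), fundamentalRep_injective (Fin N), fundamentalRep_mem_unitaryGroup⟩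
  obtain ⟨C₁, A, c, hC₁, hc, hlow⟩ := restricted_torus_lower_axisHolonomy r
  refine ⟨c, hc, fun P hd β ε hβ hcε => ?_⟩
  obtain ⟨d, L, m, K, hd1, hL⟩ := P
  simp only at hd
  subst hd
  set P : Params := ⟨4, L, m, K, hd1, hL⟩ with hP
  have hNpos : (0 : ℝ) < N := Nat.cast_pos.mpr (Nat.pos_of_ne_zero (NeZero.ne N))
  have hβ0 : 0 ≤ β := le_trans (by positivity) hβ
  have hb1 : 1 ≤ β / N := by rw [le_div_iff₀ hNpos]; linarith
  have hL2 : 2 ≤ P.sitesPerDir 0 := by have := P.one_lt_sitesPerDir 0; omega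
  have hbε : c ≤ β / N * (N * ε) := by rwa [show β / N * (N * ε) = β * ε by field_simp]
  rw [expect_eq_host_ratio P hβ0]
  have hden : 0 < ∫ V, Real.exp (-(β / N) * wilsonAction (fundamentalRep (Fin N)) V)
      ∂(Measure.pi fun _ : Edge 4 (P.sitesPerDir 0) => haarProbability (Matrix.specialUnitaryGroup (Fin N) ℂ)) := by
    have h := Summit.QuantumFields.YangMills.Theorems.FemtoCurvatureTwoPoint.PlaquetteVariance.partitionFunction_toReal_pos
      (d := 4) (L := P.sitesPerDir 0) (fundamentalRep (Fin N)) (continuous_fundamentalRep (Fin N)) (β / N)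
    rwa [Summit.QuantumFields.YangMills.Theorems.FemtoCurvatureTwoPointC.OneSite.partitionFunction_eq_lintegral',
      ← integral_eq_lintegral_of_nonneg_ae (ae_of_all _ fun V => (Real.exp_pos _).le)
      ((Real.measurable_exp.comp ((WilsonRP.measurable_wilsonAction (fundamentalRep (Fin N))
        (continuous_fundamentalRep (Fin N))).const_mul _)).aestronglyMeasurable)] at h
  refine div_pos ?_ hden
  -- the numerator is the host's restricted partition function `Z_{N₀,Nε}(β/N)`, positive by module 10b
  have hnum : ∀ V : GaugeConfig 4 (P.sitesPerDir 0) (Matrix.specialUnitaryGroup (Fin N) ℂ),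
      (∏ p : Plaq P 0, (if 1 - reTr (GaugeField.plaqHol (ofConfig V) p) ≤ ε then (1 : ℝ) else 0)) *
          Real.exp (-(β / N) * wilsonAction (fundamentalRep (Fin N)) V) =
        Real.exp (-(β / N) * wilsonAction (fundamentalRep (Fin N)) V) *
          ∏ q : Plaquette 4 (P.sitesPerDir 0),
            (if (N : ℝ) - WilsonRP.plaqRe (fundamentalRep (Fin N)) V q ≤ N * ε then (1 : ℝ) else 0) := by
    intro V
    rw [smallField_ofConfig P ε V, mul_comm]
  simp_rw [hnum]
  have hmeas : Measurable fun V : GaugeConfig 4 (P.sitesPerDir 0) (Matrix.specialUnitaryGroup (Fin N) ℂ) =>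
      Real.exp (-(β / N) * wilsonAction (fundamentalRep (Fin N)) V) *
        ∏ q : Plaquette 4 (P.sitesPerDir 0),
          (if (N : ℝ) - WilsonRP.plaqRe (fundamentalRep (Fin N)) V q ≤ N * ε then (1 : ℝ) else 0) := by
    refine (Real.measurable_exp.comp ((WilsonRP.measurable_wilsonAction (fundamentalRep (Fin N))
      (continuous_fundamentalRep (Fin N))).const_mul _)).mul (Finset.measurable_prod _ fun q _ => ?_)
    exact Measurable.ite (measurableSet_le (measurable_const.sub (WilsonRP.measurable_plaqRe (fundamentalRep (Fin N))
      (continuous_fundamentalRep (Fin N)) q)) measurable_const) measurable_const measurable_const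
  rw [integral_eq_lintegral_of_nonneg_ae (ae_of_all _ fun V => mul_nonneg (Real.exp_pos _).le
    (smallField_nonneg_le_one (fundamentalRep (Fin N)) (N * ε) V).1) hmeas.aestronglyMeasurable]
  have h := hlow (P.sitesPerDir 0) (β / N) (N * ε) hL2 hb1 hbε
  refine lt_of_lt_of_le ?_ h
  exact mul_pos (mul_pos (Real.exp_pos _) (pow_pos (mul_pos hC₁ (Real.rpow_pos_of_pos (by linarith) _)) _))
    (Summit.QuantumFields.YangMills.Theorems.FemtoCurvatureTwoPoint.PlaquetteVariance.partitionFunction_toReal_pos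
      (d := 4) (L := 1) (fundamentalRep (Fin N)) (continuous_fundamentalRep (Fin N)) _)

end NonNull

/-! ## §5 CONDITIONAL «LCS-0» FOR PLAQUETTE SETS: every plaquette lies in the closed unit cube of its base point -/

section Plaquettes

/-- **Plaquette energies are dominated by the cube energies of their base points**:
`Σ_{p ∈ Q} (1 − Re tr U(∂p)) ≤ Σ_{c ∈ x(Q)} E_c(U)`, `x(Q)` the set of base points of `Q`. [folklore] -/
theorem plaqSum_le_cubeSum (P : Params) (Q : Finset (Plaq P 0)) (U : GaugeField P 0 (Matrix.specialUnitaryGroup (Fin N) ℂ)) :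
    ∑ p ∈ Q, (1 - reTr (GaugeField.plaqHol U p)) ≤
      ∑ c ∈ Q.image (fun p : Plaq P 0 => (p.src : BlockIdx P.d (P.sitesPerDir 0))), (∑ p : Plaq P 0, if (∀ κ, p.src κ = c κ ∨ (κ ≠ p.μ ∧ κ ≠ p.ν ∧ p.src κ = c κ + 1)) then (1 - reTr (GaugeField.plaqHol U p)) else 0) := by
  classical
  rw [← Finset.sum_fiberwise_of_maps_to (s := Q) (t := Q.image (fun p : Plaq P 0 => (p.src : BlockIdx P.d (P.sitesPerDir 0))))
    (g := fun p : Plaq P 0 => (p.src : BlockIdx P.d (P.sitesPerDir 0))) (fun p hp => Finset.mem_image_of_mem _ hp)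
    (fun p => 1 - reTr (GaugeField.plaqHol U p))]
  refine Finset.sum_le_sum fun c _ => ?_
  rw [← Finset.sum_filter]
  refine Finset.sum_le_sum_of_subset_of_nonneg (fun p hp => ?_) (fun p _ _ => (plaqTerm_mem U p).1)
  simp only [Finset.mem_filter, Finset.mem_univ, true_and] at hp ⊢
  exact fun κ => Or.inl (congrFun hp.2 κ)

/-- **CONDITIONAL LOCAL STABILITY AT LEVEL 0, PLAQUETTE FORM.**  There are `C = C(N) ≥ 0` and `c = c(N) > 0` such that for every `d = 4`
parameter set `P`, every `β ≥ 4N`, every threshold with `βε ≥ c`, every `0 ≤ t ≤ β∕32` and every finite set `Q` of level-0 plaquettes: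

  `⟨e^{t·Σ_{p∈Q}(1 − Re tr U(∂p))} · ∏_p 𝟙[1 − Re tr U(∂p) ≤ ε]⟩_{P,β} ∕ ⟨∏_p 𝟙[1 − Re tr U(∂p) ≤ ε]⟩_{P,β} ≤ exp(C·(t∕β)·#Q)`

— the conditional (small-field-restricted) twin of module 7's `expect_exp_plaqSum_le` (there: `⟨e^{aβΣ_Q A}⟩ ≤ e^{CaQ}` unrestricted; here
`t = aβ`): local exponential moments of plaquette energies CONDITIONED on the global small-field event are `e^{O(1)·#Q}` at the natural scale
`1∕β`, uniformly in `β` and in the volume; the restricted state is non-null by `expect_smallField_pos`. [folklore] -/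
theorem condLCS_exp_plaqSum (N : ℕ) [NeZero N] :
    ∃ C c : ℝ, 0 ≤ C ∧ 0 < c ∧ ∀ (P : Params), P.d = 4 → ∀ (β ε t : ℝ), 4 * N ≤ β → c ≤ β * ε → 0 ≤ t → t ≤ β / 32 →
      ∀ Q : Finset (Plaq P 0),
        Missing.expect (G := Matrix.specialUnitaryGroup (Fin N) ℂ) P β
            (fun U => Real.exp (t * ∑ p ∈ Q, (1 - reTr (GaugeField.plaqHol U p))) * ∏ p : Plaq P 0, (if 1 - reTr (GaugeField.plaqHol U p) ≤ ε then (1 : ℝ) else 0)) /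
          Missing.expect (G := Matrix.specialUnitaryGroup (Fin N) ℂ) P β (fun U => ∏ p : Plaq P 0, (if 1 - reTr (GaugeField.plaqHol U p) ≤ ε then (1 : ℝ) else 0)) ≤
        Real.exp (C * (t / β) * Q.card) := by
  classical
  obtain ⟨C, c, hc, hcube⟩ := condLCS_exp_cubeEnergy N
  obtain ⟨c', hc', hpos⟩ := expect_smallField_pos N
  refine ⟨max C 0, max c c', le_max_right _ _, lt_max_of_lt_left hc, fun P hd β ε t hβ hcε ht0 ht Q => ?_⟩
  have hcε1 : c ≤ β * ε := (le_max_left _ _).trans hcε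
  have hcε2 : c' ≤ β * ε := (le_max_right _ _).trans hcε
  have hNpos : (0 : ℝ) < N := Nat.cast_pos.mpr (Nat.pos_of_ne_zero (NeZero.ne N))
  have hβpos : 0 < β := lt_of_lt_of_le (by positivity) hβ
  have hβ0 : 0 ≤ β := hβpos.le
  have hW := hpos P hd β ε hβ hcε2
  set S : Finset (BlockIdx P.d (P.sitesPerDir 0)) := Q.image (fun p : Plaq P 0 => (p.src : BlockIdx P.d (P.sitesPerDir 0))) with hS
  have hSQ : S.card ≤ Q.card := Finset.card_image_le
  -- the weight `w = 𝟙[· ≤ ε]`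
  have hw0 : ∀ s : ℝ, 0 ≤ (if s ≤ ε then (1 : ℝ) else 0) := fun s => by split_ifs <;> norm_num
  have hwm : Measurable fun s : ℝ => (if s ≤ ε then (1 : ℝ) else 0) :=
    Measurable.ite measurableSet_Iic measurable_const measurable_const
  have hwb : ∃ K : ℝ, ∀ s : ℝ, (if s ≤ ε then (1 : ℝ) else 0) ≤ K := ⟨1, fun s => by split_ifs <;> norm_num⟩
  -- (1) `e^{tΣ_Q A} ≤ ∏_{c ∈ S} e^{tE_c}` pointwise, hence in the weighted expectation
  have hmono : Missing.expect (G := Matrix.specialUnitaryGroup (Fin N) ℂ) P β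
        (fun U => Real.exp (t * ∑ p ∈ Q, (1 - reTr (GaugeField.plaqHol U p))) * ∏ p : Plaq P 0, (if 1 - reTr (GaugeField.plaqHol U p) ≤ ε then (1 : ℝ) else 0)) ≤
      Missing.expect (G := Matrix.specialUnitaryGroup (Fin N) ℂ) P β
        (fun U => (∏ c ∈ S, Real.exp (t * (∑ p : Plaq P 0, if (∀ κ, p.src κ = c κ ∨ (κ ≠ p.μ ∧ κ ≠ p.ν ∧ p.src κ = c κ + 1)) then (1 - reTr (GaugeField.plaqHol U p)) else 0))) * ∏ p : Plaq P 0, (if 1 - reTr (GaugeField.plaqHol U p) ≤ ε then (1 : ℝ) else 0)) := by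
    have hQm : Measurable fun U : GaugeField P 0 (Matrix.specialUnitaryGroup (Fin N) ℂ) => ∑ p ∈ Q, (1 - reTr (GaugeField.plaqHol U p)) :=
      Finset.measurable_sum _ fun p _ => measurable_const.sub (RegularGaugeGroup.measurable_reTr.comp
        (Missing.measurable_plaqHol (G := Matrix.specialUnitaryGroup (Fin N) ℂ) p))
    have hQle : ∀ U : GaugeField P 0 (Matrix.specialUnitaryGroup (Fin N) ℂ), |∑ p ∈ Q, (1 - reTr (GaugeField.plaqHol U p))| ≤ 2 * Q.card := fun U => by
      rw [abs_of_nonneg (Finset.sum_nonneg fun p _ => (plaqTerm_mem U p).1)]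
      calc ∑ p ∈ Q, (1 - reTr (GaugeField.plaqHol U p)) ≤ ∑ _p ∈ Q, (2 : ℝ) := Finset.sum_le_sum fun p _ => (plaqTerm_mem U p).2
        _ = 2 * Q.card := by rw [Finset.sum_const, nsmul_eq_mul, mul_comm]
    have hFm : ∀ c : BlockIdx P.d (P.sitesPerDir 0), Measurable fun U : GaugeField P 0 (Matrix.specialUnitaryGroup (Fin N) ℂ) =>
        Real.exp (t * (∑ p : Plaq P 0, if (∀ κ, p.src κ = c κ ∨ (κ ≠ p.μ ∧ κ ≠ p.ν ∧ p.src κ = c κ + 1)) then (1 - reTr (GaugeField.plaqHol U p)) else 0)) := fun c =>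
      Real.measurable_exp.comp ((measurable_cubeEnergy c).const_mul t)
    refine expect_mul_prod_mono (N := N) P hβ0 hw0 hwm hwb (Real.measurable_exp.comp (hQm.const_mul t))
      (Finset.measurable_prod _ fun c _ => hFm c)
      ⟨Real.exp (t * (2 * Q.card)), fun U => by
        rw [Real.abs_exp]
        exact Real.exp_le_exp.2 (mul_le_mul_of_nonneg_left ((le_abs_self _).trans (hQle U)) ht0)⟩
      ⟨Real.exp (t * (2 * Fintype.card (Plaq P 0))) ^ S.card, fun U => by
        rw [Finset.abs_prod, ← Finset.prod_const]
        exact Finset.prod_le_prod (fun c _ => abs_nonneg _) fun c _ => by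
          rw [abs_of_nonneg (Real.exp_pos _).le]
          exact Real.exp_le_exp.2 (mul_le_mul_of_nonneg_left (cubeEnergy_mem c U).2 ht0)⟩
      fun U => ?_
    rw [← Real.exp_sum, ← Finset.mul_sum]
    exact Real.exp_le_exp.2 (mul_le_mul_of_nonneg_left (plaqSum_le_cubeSum P Q U) ht0)
  -- (2) module 12 on the cube set `S`, `#S ≤ #Q`, `C ≤ max C 0`
  have hS' := hcube P hd β ε t hβ hcε1 ht0 ht hW S
  calc Missing.expect (G := Matrix.specialUnitaryGroup (Fin N) ℂ) P β
          (fun U => Real.exp (t * ∑ p ∈ Q, (1 - reTr (GaugeField.plaqHol U p))) * ∏ p : Plaq P 0, (if 1 - reTr (GaugeField.plaqHol U p) ≤ ε then (1 : ℝ) else 0)) /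
        Missing.expect (G := Matrix.specialUnitaryGroup (Fin N) ℂ) P β (fun U => ∏ p : Plaq P 0, (if 1 - reTr (GaugeField.plaqHol U p) ≤ ε then (1 : ℝ) else 0))
      ≤ Missing.expect (G := Matrix.specialUnitaryGroup (Fin N) ℂ) P β
          (fun U => (∏ c ∈ S, Real.exp (t * (∑ p : Plaq P 0, if (∀ κ, p.src κ = c κ ∨ (κ ≠ p.μ ∧ κ ≠ p.ν ∧ p.src κ = c κ + 1)) then (1 - reTr (GaugeField.plaqHol U p)) else 0))) * ∏ p : Plaq P 0, (if 1 - reTr (GaugeField.plaqHol U p) ≤ ε then (1 : ℝ) else 0)) /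
        Missing.expect (G := Matrix.specialUnitaryGroup (Fin N) ℂ) P β (fun U => ∏ p : Plaq P 0, (if 1 - reTr (GaugeField.plaqHol U p) ≤ ε then (1 : ℝ) else 0)) :=
        div_le_div_of_nonneg_right hmono hW.le
    _ ≤ Real.exp (C * (t / β) * S.card) := hS'
    _ ≤ Real.exp (max C 0 * (t / β) * Q.card) := by
        refine Real.exp_le_exp.2 ?_
        have htβ : 0 ≤ t / β := div_nonneg ht0 hβ0
        have hSQ' : (S.card : ℝ) ≤ Q.card := by exact_mod_cast hSQ
        calc C * (t / β) * S.card ≤ max C 0 * (t / β) * S.card :=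
              mul_le_mul_of_nonneg_right (mul_le_mul_of_nonneg_right (le_max_left _ _) htβ) (Nat.cast_nonneg _)
          _ ≤ max C 0 * (t / β) * Q.card := mul_le_mul_of_nonneg_left hSQ' (mul_nonneg (le_max_right _ _) htβ)

end Plaquettes

/-! ## §6 The same in the HISTORY-TERM CURRENCY: the two conjuncts of `LocCondStability`'s shape for the restricted level-0 density -/

section HistoryTerm

/-- **CONDITIONAL «LCS-0» IN THE HISTORY-TERM CURRENCY** (un-normalised: the restricted level-0 density `χ_ε·e^{−βA}`, `χ_ε = ∏_p 𝟙[1 − Re tr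
U(∂p) ≤ ε]`, against the product Haar measure — the shape of the two conjuncts of `Spine/NE7b/LocalConditionalStability.LocCondStability` for a
history term whose level-0 density is `χ_ε·ρ₀`, cf. module 7's `lcs_boltzmann` for `ρ₀` alone): with `C, c` of `condLCS_exp_plaqSum`, for `d = 4`,
`β ≥ 4N`, `βε ≥ c`, `0 ≤ t ≤ β∕32` and every finite plaquette set `Q`, the carrier `M = e^{t·Σ_{p∈Q}(1 − Re tr U(∂p))}` satisfies
`Integrable (M·χ_ε·e^{−βA}) ∏dU` and `∫ M·χ_ε·e^{−βA} ∏dU ≤ e^{C·(t∕β)·#Q} · ∫ χ_ε·e^{−βA} ∏dU`. [folklore] -/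
theorem condLCS_boltzmann (N : ℕ) [NeZero N] :
    ∃ C c : ℝ, 0 ≤ C ∧ 0 < c ∧ ∀ (P : Params), P.d = 4 → ∀ (β ε t : ℝ), 4 * N ≤ β → c ≤ β * ε → 0 ≤ t → t ≤ β / 32 →
      ∀ Q : Finset (Plaq P 0),
        Integrable (fun U : GaugeField P 0 (Matrix.specialUnitaryGroup (Fin N) ℂ) =>
            (Real.exp (t * ∑ p ∈ Q, (1 - reTr (GaugeField.plaqHol U p))) * ∏ p : Plaq P 0, (if 1 - reTr (GaugeField.plaqHol U p) ≤ ε then (1 : ℝ) else 0)) * Missing.boltzmann P β U)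
          (fieldMeasure P 0 (Matrix.specialUnitaryGroup (Fin N) ℂ)) ∧
        ∫ U, (Real.exp (t * ∑ p ∈ Q, (1 - reTr (GaugeField.plaqHol U p))) * ∏ p : Plaq P 0, (if 1 - reTr (GaugeField.plaqHol U p) ≤ ε then (1 : ℝ) else 0)) * Missing.boltzmann P β U
            ∂(fieldMeasure P 0 (Matrix.specialUnitaryGroup (Fin N) ℂ)) ≤
          Real.exp (C * (t / β) * Q.card) *
            ∫ U, (∏ p : Plaq P 0, (if 1 - reTr (GaugeField.plaqHol U p) ≤ ε then (1 : ℝ) else 0)) * Missing.boltzmann P β U ∂(fieldMeasure P 0 (Matrix.specialUnitaryGroup (Fin N) ℂ)) := by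
  obtain ⟨C, c, hC0, hc, hlcs⟩ := condLCS_exp_plaqSum N
  obtain ⟨c', hc', hpos⟩ := expect_smallField_pos N
  refine ⟨C, max c c', hC0, lt_max_of_lt_left hc, fun P hd β ε t hβ hcε ht0 ht Q => ?_⟩
  have hcε1 : c ≤ β * ε := (le_max_left _ _).trans hcε
  have hcε2 : c' ≤ β * ε := (le_max_right _ _).trans hcε
  have hNpos : (0 : ℝ) < N := Nat.cast_pos.mpr (Nat.pos_of_ne_zero (NeZero.ne N))
  have hβ0 : 0 ≤ β := le_trans (by positivity) hβ
  -- bounds and measurability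
  have hQm : Measurable fun U : GaugeField P 0 (Matrix.specialUnitaryGroup (Fin N) ℂ) => ∑ p ∈ Q, (1 - reTr (GaugeField.plaqHol U p)) :=
    Finset.measurable_sum _ fun p _ => measurable_const.sub (RegularGaugeGroup.measurable_reTr.comp
      (Missing.measurable_plaqHol (G := Matrix.specialUnitaryGroup (Fin N) ℂ) p))
  have hWm : Measurable fun U : GaugeField P 0 (Matrix.specialUnitaryGroup (Fin N) ℂ) => ∏ p : Plaq P 0, (if 1 - reTr (GaugeField.plaqHol U p) ≤ ε then (1 : ℝ) else 0) :=
    Finset.measurable_prod _ fun p _ => Measurable.ite (measurableSet_le (measurable_const.sub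
      (RegularGaugeGroup.measurable_reTr.comp (Missing.measurable_plaqHol (G := Matrix.specialUnitaryGroup (Fin N) ℂ) p)))
        measurable_const) measurable_const measurable_const
  have hW01 : ∀ U : GaugeField P 0 (Matrix.specialUnitaryGroup (Fin N) ℂ), 0 ≤ (∏ p : Plaq P 0, (if 1 - reTr (GaugeField.plaqHol U p) ≤ ε then (1 : ℝ) else 0)) ∧ (∏ p : Plaq P 0, (if 1 - reTr (GaugeField.plaqHol U p) ≤ ε then (1 : ℝ) else 0)) ≤ 1 := fun U => by
    rw [Finset.prod_boole]
    split_ifs <;> norm_num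
  have hQle : ∀ U : GaugeField P 0 (Matrix.specialUnitaryGroup (Fin N) ℂ), |∑ p ∈ Q, (1 - reTr (GaugeField.plaqHol U p))| ≤ 2 * Q.card := fun U => by
    rw [abs_of_nonneg (Finset.sum_nonneg fun p _ => (plaqTerm_mem U p).1)]
    calc ∑ p ∈ Q, (1 - reTr (GaugeField.plaqHol U p)) ≤ ∑ _p ∈ Q, (2 : ℝ) := Finset.sum_le_sum fun p _ => (plaqTerm_mem U p).2
      _ = 2 * Q.card := by rw [Finset.sum_const, nsmul_eq_mul, mul_comm]
  have hint : Integrable (fun U : GaugeField P 0 (Matrix.specialUnitaryGroup (Fin N) ℂ) =>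
      (Real.exp (t * ∑ p ∈ Q, (1 - reTr (GaugeField.plaqHol U p))) * ∏ p : Plaq P 0, (if 1 - reTr (GaugeField.plaqHol U p) ≤ ε then (1 : ℝ) else 0)) * Missing.boltzmann P β U) (fieldMeasure P 0 (Matrix.specialUnitaryGroup (Fin N) ℂ)) := by
    refine Missing.integrable_mul_boltzmann RegularGaugeGroup.measurable_reTr hβ0 ((Real.measurable_exp.comp (hQm.const_mul t)).mul hWm)
      (C := Real.exp (t * (2 * Q.card))) fun U => ?_
    rw [abs_mul, abs_of_nonneg (hW01 U).1, Real.abs_exp]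
    calc Real.exp (t * ∑ p ∈ Q, (1 - reTr (GaugeField.plaqHol U p))) * (∏ p : Plaq P 0, (if 1 - reTr (GaugeField.plaqHol U p) ≤ ε then (1 : ℝ) else 0))
        ≤ Real.exp (t * (2 * Q.card)) * 1 :=
          mul_le_mul (Real.exp_le_exp.2 (mul_le_mul_of_nonneg_left ((le_abs_self _).trans (hQle U)) ht0)) (hW01 U).2
            (hW01 U).1 (Real.exp_pos _).le
      _ = Real.exp (t * (2 * Q.card)) := mul_one _
  refine ⟨hint, ?_⟩
  -- the normalised inequality of §5, un-normalised
  have h := hlcs P hd β ε t hβ hcε1 ht0 ht Q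
  have hW := hpos P hd β ε hβ hcε2
  have hZ := Missing.partitionFn_pos' (G := Matrix.specialUnitaryGroup (Fin N) ℂ) P hβ0
  unfold Missing.expect at h hW
  rw [div_div_div_cancel_right₀ hZ.ne', div_le_iff₀ (by
    have := mul_pos hW hZ
    rwa [div_mul_cancel₀ _ hZ.ne'] at this)] at h
  exact h

end HistoryTerm

end Summit.QuantumFields.YangMills.BalabanUVNodes.N20LCSConditional

end
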